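import Literature.AnabelianGeometry.SemiGraphs.CosetCategoriesBridge
import Literature.AlgebraicGeometry.Frobenioids.QuasiTemperoidPushforward
import Literature.AlgebraicGeometry.Frobenioids.QuasiTemperoidConnectedPart
import Literature.AlgebraicGeometry.Frobenioids.QuasiTemperoidInductionFunctor
import HarnessLib

/-!
# The small coset model commutes with push-forward and pull-back ([FrdII] Ex. 1.3 (ii); [IUTchI] Ex. 3.3 (i))

Mochizuki, *The geometry of Frobenioids II*, Kyushu J. Math. **62** (2008), §1 Example 1.3 (ii), author's text p. 11
[cite: MochizukiFrdII2008, Ex 1.3 (ii) p.11]: "`φ` induces a natural functor `φ_* : 𝓑^temp(Π₁)⁰ → 𝓑^temp(Π₂)⁰` … obtained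
by mapping a `Π₁`-set `E` to the `φ(Π₁)`-set `E' := E/Ker(φ)` … [and] the pull-back functor `𝓑^temp(Π₂)⁰ → 𝓑^temp(Π₁)⁰`
[i.e., obtained by composing the `Π₂`-action on a `Π₂`-set `F₂` with `φ` so as to obtain a `Π₁`-set `F₁`]"; Mochizuki,
*Inter-universal Teichmüller Theory I*, Ex. 3.3 (i) pp. 77–78 [cite: Mochizuki2012, I Ex 3.3 (i) pp.77-78]: "`D⊢_v ⊆ D_v`
… by pulling back … a natural functor `D_v → D⊢_v`".

The tree carries TWO models of these functors: on the BIG categories `ConnectedPart (BTemp Π)` (abc-iut-L1's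
`QuasiTemperoid.pullback` = restriction of scalars, `QuasiTemperoid.inductionFunctorConnected` = `E ↦ Π₂ ×^{Π₁} E`, used
in [FrdII] Ex. 1.3 (iii)'s `galoisBaseFunctor`), and on abc-iut-L5-t2's SMALL coset categories `CosetCat Π` (`CosetCat.pull`
= `V ↦ φ⁻¹V`, `CosetCat.push` = `U ↦ φ(U)`, used for [IUTchI] Ex. 3.3's `D_v ⊇ D⊢_v` and for [FrdII] Ex. 1.3 (iii) /
§2's Datum-compatible bases). `CosetCategoriesBridge.lean` identified the MODELS (`CosetCat.toConnected : CosetCat Π ⥤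
ConnectedPart (BTemp Π)`, an equivalence for tempered `Π`). THIS file identifies the FUNCTORS along that bridge:

* `CosetCat.pullBridgeIso : pull φ ⋙ toConnected ≅ toConnected ⋙ QuasiTemperoid.pullback φ` (`φ : Π₁ ↠ Π₂` continuous
  surjective): componentwise the bijection `Π₁/φ⁻¹V ≃ Π₂/V`, `π ↦ φ π` (`CosetCat.quotAugEquiv`), `Π₁`-equivariant;
* `CosetCat.pushBridgeIso : push φ ⋙ toConnected ≅ toConnected ⋙ QuasiTemperoid.inductionFunctorConnected φ`
  (`φ : Π₁ → Π₂` an open map): componentwise the bijection `Π₂/φ(U) ≃ Π₂ ×^{Π₁} (Π₁/U)`, `qφ(U) ↦ [(q, 1·U)]`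
  (`CosetCat.pushBridgeFun`, inverse `[(q, gU)] ↦ q φ(g) φ(U)`), `Π₂`-equivariant and natural.
Hence the small-model composites used as bases of `p`-adic Frobenioid data ARE print's functors transported along the
equivalences of `CosetCategoriesBridge.lean`. Pure topological-group / category theory over Mathlib and landed files;
nothing of the disputed series is asserted; no statement of the papers is strengthened.
-/

namespace Literature.AnabelianGeometry.SemiGraphs

namespace CosetCat

open CategoryTheory Literature.AlgebraicGeometry.Frobenioids Literature.AlgebraicGeometry.Frobenioids.QuasiTemperoid

universe u

/-! ### Pull-back: `pull φ ⋙ toConnected ≅ toConnected ⋙ pullback φ` -/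

section Pull

variable {G₁ : Type u} [Group G₁] [TopologicalSpace G₁] [IsTopologicalGroup G₁]
  {G₂ : Type u} [Group G₂] [TopologicalSpace G₂] [IsTopologicalGroup G₂]
  (hG₁ : IsTempered G₁) (hG₂ : IsTempered G₂) (φ : G₁ →* G₂) (hc : Continuous φ) (hs : Function.Surjective φ)

/-- The comparison morphism at `Π₂/V`: `Π₁/φ⁻¹V → (Π₂/V)|_{Π₁}`, `π·φ⁻¹V ↦ φ(π)·V`, a morphism of `Π₁`-sets in
`𝓑^temp(Π₁)⁰` (equivariance = `CosetCat.quotAugEquiv_smul`). [cite: MochizukiFrdII2008, Ex 1.3 (ii) p.11] -/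
noncomputable def pullBridgeHom (V : CosetCat G₂) :
    (toConnected hG₁).obj ((pull φ hc hs).obj V) ⟶ (QuasiTemperoid.pullback φ hs hc).obj ((toConnected hG₂).obj V) :=
  ObjectProperty.homMk (ObjectProperty.homMk
    { hom := TypeCat.ofHom (quotAugEquiv φ hc hs V.sg)
      comm := fun g => by
        apply ConcreteCategory.hom_ext
        intro x
        exact quotAugEquiv_smul φ hc hs V.sg g x })

/-- The comparison morphism on points: `π·φ⁻¹V ↦ φ(π)·V`. [cite: MochizukiFrdII2008, Ex 1.3 (ii) p.11] -/
theorem pullBridgeHom_apply (V : CosetCat G₂) (x : ((pull φ hc hs).obj V).carrier) :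
    ((pullBridgeHom hG₁ hG₂ φ hc hs V).hom.hom.hom x : V.carrier) = quotAugEquiv φ hc hs V.sg x :=
  rfl

/-- The comparison morphism is an isomorphism (it is bijective). [cite: MochizukiFrdII2008, Ex 1.3 (ii) p.11] -/
theorem isIso_pullBridgeHom (V : CosetCat G₂) : IsIso (pullBridgeHom hG₁ hG₂ φ hc hs V) := by
  haveI : IsIso (pullBridgeHom hG₁ hG₂ φ hc hs V).hom :=
    BTempConnected.isIso_of_bijective _ (quotAugEquiv φ hc hs V.sg).bijective
  haveI : IsIso ((connectedObjects (BTemp G₁)).ι.map (pullBridgeHom hG₁ hG₂ φ hc hs V)) := by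
    change IsIso (pullBridgeHom hG₁ hG₂ φ hc hs V).hom
    infer_instance
  exact isIso_of_fully_faithful (connectedObjects (BTemp G₁)).ι _

/-- **`pull φ ⋙ toConnected ≅ toConnected ⋙ pullback φ`**: on the small coset models, abc-iut-L5-t2's `CosetCat.pull`
(`V ↦ φ⁻¹V`) IS the printed pull-back functor "[composing the `Π₂`-action … with `φ`]" (abc-iut-L1's
`QuasiTemperoid.pullback`) along the bridge `CosetCat.toConnected`. [cite: MochizukiFrdII2008, Ex 1.3 (ii) p.11] -/
noncomputable def pullBridgeIso :
    pull φ hc hs ⋙ toConnected hG₁ ≅ toConnected hG₂ ⋙ QuasiTemperoid.pullback φ hs hc := by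
  refine NatIso.ofComponents
    (fun V => @asIso _ _ _ _ (pullBridgeHom hG₁ hG₂ φ hc hs V) (isIso_pullBridgeHom hG₁ hG₂ φ hc hs V)) ?_
  intro V V' f
  apply ObjectProperty.hom_ext
  apply BTempConnected.hom_ext_apply
  intro x
  change quotAugEquiv φ hc hs V'.sg (Hom.toFun ((pull φ hc hs).map f) x) =
    Hom.toFun f (quotAugEquiv φ hc hs V.sg x)
  rw [pull_map_toFun]
  exact (quotAugEquiv φ hc hs V'.sg).apply_symm_apply _

end Pull

/-! ### Push-forward / induction: `push φ ⋙ toConnected ≅ toConnected ⋙ inductionFunctorConnected φ` -/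

section Push

variable {G : Type u} [Group G] [TopologicalSpace G] [IsTopologicalGroup G]
  {Q : Type u} [Group Q] [TopologicalSpace Q] (hG : IsTempered G) (φ : G →* Q) (ho : IsOpenMap φ)

/-- For `a⁻¹ b ∈ φ(U)`: `[(a, 1·U)] = [(b, 1·U)]` in `Π₂ ×^{Π₁} (Π₁/U)` (if `b = a φ(u)` then
`[(a φ(u), 1·U)] = [(a, u·U)] = [(a, 1·U)]`). [cite: MochizukiFrdII2008, Ex 1.3 (ii) p.11] -/
theorem inducedMk_one_eq_of_rel (U : CosetCat G) {a b : Q} (h : a⁻¹ * b ∈ (mapOpen φ ho U.sg).toSubgroup) :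
    (inducedMk a ((1 : G) : U.carrier) : InducedSet φ ((toBTemp hG).obj U)) = inducedMk b ((1 : G) : U.carrier) := by
  obtain ⟨u, hu, hφu⟩ := (mem_mapOpen φ ho).mp h
  have hb : b = a * φ u := by rw [hφu, mul_inv_cancel_left]
  rw [hb, inducedMk_mul]
  congr 1
  exact ((smul_one_eq_one_iff U u).mpr hu).symm

/-- The comparison map on points `Π₂/φ(U) → Π₂ ×^{Π₁} (Π₁/U)`, `q φ(U) ↦ [(q, 1·U)]`.
[cite: MochizukiFrdII2008, Ex 1.3 (ii) p.11] -/
noncomputable def pushBridgeFun (U : CosetCat G) :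
    ((push φ ho).obj U).carrier → InducedSet φ ((toBTemp hG).obj U) :=
  fun c => Quotient.liftOn' c (fun q => inducedMk q ((1 : G) : U.carrier)) fun _ _ hab =>
    inducedMk_one_eq_of_rel hG φ ho U (QuotientGroup.leftRel_apply.mp hab)

/-- `pushBridgeFun` on a coset. [cite: MochizukiFrdII2008, Ex 1.3 (ii) p.11] -/
@[simp] theorem pushBridgeFun_coe (U : CosetCat G) (q : Q) :
    pushBridgeFun hG φ ho U ((q : Q) : ((push φ ho).obj U).carrier) = inducedMk q ((1 : G) : U.carrier) :=
  rfl

omit [TopologicalSpace Q] in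
/-- `[(q, g·U)] = [(q φ(g), 1·U)]`: every class is in the image of `pushBridgeFun`. [cite: MochizukiFrdII2008, Ex 1.3 (ii) p.11] -/
theorem inducedMk_coe_eq (U : CosetCat G) (q : Q) (g : G) :
    (inducedMk q ((g : G) : U.carrier) : InducedSet φ ((toBTemp hG).obj U)) =
      inducedMk (q * φ g) ((1 : G) : U.carrier) := by
  rw [inducedMk_mul]
  congr 1
  change (g : U.carrier) = g • ((1 : G) : U.carrier)
  rw [MulAction.Quotient.smul_coe, smul_eq_mul, mul_one]

/-- `pushBridgeFun` is bijective. [cite: MochizukiFrdII2008, Ex 1.3 (ii) p.11] -/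
theorem pushBridgeFun_bijective (U : CosetCat G) : Function.Bijective (pushBridgeFun hG φ ho U) := by
  constructor
  · intro c c'
    refine QuotientGroup.induction_on c fun a => QuotientGroup.induction_on c' fun b => fun h => ?_
    rw [pushBridgeFun_coe, pushBridgeFun_coe, inducedMk_eq_iff] at h
    obtain ⟨g, hb, h1⟩ := h
    refine QuotientGroup.eq.mpr ((mem_mapOpen φ ho).mpr ⟨g⁻¹, ?_, by rw [hb, map_inv, inv_mul_cancel_left]⟩)
    have hg : g • ((1 : G) : U.carrier) = ((1 : G) : U.carrier) := h1.symm
    exact inv_mem ((smul_one_eq_one_iff U g).mp hg)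
  · intro c
    induction c using inducedSet_ind with
    | h q x =>
      obtain ⟨g, rfl⟩ := QuotientGroup.mk_surjective x
      exact ⟨((q * φ g : Q) : ((push φ ho).obj U).carrier), by
        rw [pushBridgeFun_coe]; exact (inducedMk_coe_eq hG φ U q g).symm⟩

section WithTemperedTarget

variable [IsTopologicalGroup Q] (hQ : IsTempered Q) (hQc : ∀ V : Subgroup Q, IsOpen (V : Set Q) → Countable (Q ⧸ V))

/-- The comparison morphism at `Π₁/U`: `Π₂/φ(U) → Π₂ ×^{Π₁} (Π₁/U)` as a morphism of `𝓑^temp(Π₂)⁰` (equivariance: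
`q''·[(q, 1·U)] = [(q'' q, 1·U)]`). [cite: MochizukiFrdII2008, Ex 1.3 (ii) p.11] -/
noncomputable def pushBridgeHom (U : CosetCat G) :
    (toConnected hQ).obj ((push φ ho).obj U) ⟶ (inductionFunctorConnected φ ho hQc).obj ((toConnected hG).obj U) :=
  ObjectProperty.homMk (ObjectProperty.homMk
    { hom := TypeCat.ofHom (pushBridgeFun hG φ ho U)
      comm := fun q'' => by
        apply ConcreteCategory.hom_ext
        intro c
        obtain ⟨q, rfl⟩ := QuotientGroup.mk_surjective c
        change pushBridgeFun hG φ ho U (q'' • (q : ((push φ ho).obj U).carrier)) =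
          (inducedObj φ ho hQc ((toBTemp hG).obj U)).obj.ρ q'' (pushBridgeFun hG φ ho U (q : ((push φ ho).obj U).carrier))
        rw [MulAction.Quotient.smul_coe, smul_eq_mul, pushBridgeFun_coe, pushBridgeFun_coe, inducedObj_ρ_mk] })

/-- The comparison morphism on points. [cite: MochizukiFrdII2008, Ex 1.3 (ii) p.11] -/
theorem pushBridgeHom_apply (U : CosetCat G) (c : ((push φ ho).obj U).carrier) :
    ((pushBridgeHom hG φ ho hQ hQc U).hom.hom.hom c : InducedSet φ ((toBTemp hG).obj U)) = pushBridgeFun hG φ ho U c :=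
  rfl

/-- The comparison morphism is an isomorphism. [cite: MochizukiFrdII2008, Ex 1.3 (ii) p.11] -/
theorem isIso_pushBridgeHom (U : CosetCat G) : IsIso (pushBridgeHom hG φ ho hQ hQc U) := by
  haveI : IsIso (pushBridgeHom hG φ ho hQ hQc U).hom :=
    BTempConnected.isIso_of_bijective _ (pushBridgeFun_bijective hG φ ho U)
  haveI : IsIso ((connectedObjects (BTemp Q)).ι.map (pushBridgeHom hG φ ho hQ hQc U)) := by
    change IsIso (pushBridgeHom hG φ ho hQ hQc U).hom
    infer_instance
  exact isIso_of_fully_faithful (connectedObjects (BTemp Q)).ι _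

/-- **`push φ ⋙ toConnected ≅ toConnected ⋙ inductionFunctorConnected φ`**: on the small coset models, abc-iut-L5-t2's
`CosetCat.push` (`U ↦ φ(U)`) IS the printed functor `φ_*` "`E ↦ E/Ker(φ)`" followed by induction (abc-iut-L1's
`QuasiTemperoid.inductionFunctorConnected`, `E ↦ Π₂ ×^{Π₁} E`) along the bridge `CosetCat.toConnected`; natural in `U`
(a morphism with point `c·U'` goes to `[(q, 1·U)] ↦ [(q, c·U')] = [(q φ(c), 1·U')]` on both sides).
[cite: MochizukiFrdII2008, Ex 1.3 (ii) p.11] -/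
noncomputable def pushBridgeIso :
    push φ ho ⋙ toConnected hQ ≅ toConnected hG ⋙ inductionFunctorConnected φ ho hQc := by
  refine NatIso.ofComponents
    (fun U => @asIso _ _ _ _ (pushBridgeHom hG φ ho hQ hQc U) (isIso_pushBridgeHom hG φ ho hQ hQc U)) ?_
  intro U U' f
  apply ObjectProperty.hom_ext
  apply BTempConnected.hom_ext_apply
  intro c
  obtain ⟨q, rfl⟩ := QuotientGroup.mk_surjective c
  obtain ⟨a, ha⟩ := QuotientGroup.mk_surjective (pt f)
  change pushBridgeFun hG φ ho U' (Hom.toFun ((push φ ho).map f) (q : ((push φ ho).obj U).carrier)) =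
    (((inductionFunctor φ ho hQc).map ((toBTemp hG).map f)).hom.hom
      (pushBridgeFun hG φ ho U (q : ((push φ ho).obj U).carrier)) : InducedSet φ ((toBTemp hG).obj U'))
  rw [pushBridgeFun_coe, inductionFunctor_map_mk, toBTemp_map_apply, toFun_coe, pt_push_map, ← ha, pushQuot_coe,
    MulAction.Quotient.smul_coe, smul_eq_mul, pushBridgeFun_coe, toFun_coe, ← ha, MulAction.Quotient.smul_coe,
    smul_eq_mul, one_mul]
  exact (inducedMk_coe_eq hG φ U' q a).symm

end WithTemperedTarget

end Push

end CosetCat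

end Literature.AnabelianGeometry.SemiGraphs
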